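import Summits.AtomisticToContinuum.FouriersLaw.Theorems.EmbeddedDrudeMourreMourreDissolutionFrameworkAssembly
import Summits.AtomisticToContinuum.FouriersLaw.Theorems.EmbeddedDrudeMourreDrudeDissolutionStubPencilFrameworkPolynomials
import Literature.MathematicalPhysics.KineticTheory.FluctuationClusteringSpan

/-!
# Stub F `stub_pencilFramework` of line `gram-pencil-harmonic-chaos`, part F-c: the RICH symmetric
zero-wavenumber datum — observables the flow-orbit of the local polynomials — from scalar clustering
(crux `EmbeddedDrudeMourre.DrudeDissolution`, stmt-AtomisticToContinuum-12593; `--supports` file)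

The `𝒫`-version of the tree's `MourreDissolution.exists_zeroWavenumberData_of_clustering` (which
builds Doyon's datum on `span{(a ∘ τ_x) ∘ φ_s : a ∈ {j₀, h₀}}`). Given the dynamics `D` of
`pinnedChain ω₂ lam β γ` with `φ_0 = id`, exact group law and exact `τ`/`R` covariance; a
`D`-invariant, shift-invariant, `R`-invariant probability measure `μ` in which every local
polynomial is square integrable; and the two SCALAR analytic inputs — summability in `x` of
`Cov_μ(u, (v ∘ τ_x) ∘ φ_t)` for `u, v ∈ 𝒫` and every `t`, and continuity at `t = 0` of
`t ↦ Σ_x Cov_μ(u, (u ∘ τ_x) ∘ φ_t)` for `u ∈ 𝒫` — we build a `ZeroWavenumberData` with state `μ`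
and local observables `𝒱 = span{u ∘ φ_s : u ∈ 𝒫, s ∈ ℝ}` (translation stable because `𝒫` is and
`φ_s ∘ τ_y = τ_y ∘ φ_s`; it contains `j₀, h₀ ∈ 𝒫`), momentum-reversal symmetric (`𝒫 ∘ R = 𝒫`,
`R ∘ φ_t = φ_{-t} ∘ R`), with strongly continuous Koopman group
(`FluctuationDynamics.isStronglyContinuous_of_generators` with generating set `𝒫`).
-/

noncomputable section

namespace Summit.AtomisticToContinuum.FouriersLaw.Theorems.DrudeDissolution.GramPencilHarmonicChaos

open MeasureTheory ProbabilityTheory Filter Set Function Topology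
open scoped InnerProductSpace ENNReal
open Literature.MathematicalPhysics.KineticTheory
open Literature.MathematicalPhysics.KineticTheory.HeatConduction

/-- **Stationarity reduction**: for a `φ`-invariant `μ`, exact group law and exact `τ` covariance,
`Cov(u ∘ φ_{s₁}, (v ∘ φ_{s₂}) ∘ τ_x) = Cov(u, (v ∘ τ_x) ∘ φ_{s₂ - s₁})`. [folklore] -/
theorem cov_flow_flow_shift {P : OscillatorChain} {D : InfiniteChainDynamics P}
    (hgrp : ∀ t s : ℝ, D.flow (t + s) = D.flow t ∘ D.flow s)
    (hsh : ∀ (t : ℝ) (x : ℤ), D.flow t ∘ chainShift x = chainShift x ∘ D.flow t)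
    {μ : Measure ChainConfig} (hflow : ∀ t, MeasurePreserving (D.flow t) μ μ)
    (hT : ∀ x, MeasurePreserving (chainShift x) μ μ)
    {u v : ChainConfig → ℝ} (hu : AEStronglyMeasurable u μ) (hv : AEStronglyMeasurable v μ)
    (x : ℤ) (s₁ s₂ : ℝ) :
    cov[u ∘ D.flow s₁, (v ∘ D.flow s₂) ∘ chainShift x; μ] =
      cov[u, (v ∘ chainShift x) ∘ D.flow (s₂ - s₁); μ] := by
  have hae : ∀ {f : ChainConfig → ℝ}, AEStronglyMeasurable f μ → ∀ {g : ChainConfig → ChainConfig},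
      MeasurePreserving g μ μ → AEStronglyMeasurable (f ∘ g) μ := by
    intro f hf g hg
    have h : AEStronglyMeasurable f (μ.map g) := by rwa [hg.map_eq]
    exact h.comp_measurable hg.measurable
  have e : (v ∘ D.flow s₂) ∘ chainShift x = ((v ∘ chainShift x) ∘ D.flow (s₂ - s₁)) ∘ D.flow s₁ := by
    have h2 : D.flow s₂ = D.flow (s₂ - s₁) ∘ D.flow s₁ := by rw [← hgrp, sub_add_cancel]
    calc (v ∘ D.flow s₂) ∘ chainShift x = v ∘ (D.flow s₂ ∘ chainShift x) := rfl
      _ = v ∘ (chainShift x ∘ D.flow s₂) := by rw [hsh]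
      _ = (v ∘ chainShift x) ∘ D.flow s₂ := rfl
      _ = ((v ∘ chainShift x) ∘ D.flow (s₂ - s₁)) ∘ D.flow s₁ := by rw [h2]; rfl
  rw [e, covariance_comp_measurePreserving (hflow s₁) hu (hae (hae hv (hT x)) (hflow _))]

/-- **Part F-c of stub F (registered helper): the rich symmetric zero-wavenumber datum from scalar
clustering inputs.** Inputs: a dynamics `D` of `pinnedChain ω₂ lam β γ` with `φ_0 = id`, exact
group law and exact `τ`/`R` covariance; a `D`-invariant, shift-invariant, `R`-invariant probability
measure `μ` with `𝒫 ⊆ L²(μ)`; summable `x ↦ Cov(u, (v ∘ τ_x) ∘ φ_t)` (`u, v ∈ 𝒫`, all `t`) and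
continuity at `0` of `t ↦ Σ_x Cov(u, (u ∘ τ_x) ∘ φ_t)` (`u ∈ 𝒫`). Output: a
`ZeroWavenumberData (pinnedChain ω₂ lam β γ) D` with state `μ`, momentum-reversal symmetric, with
strongly continuous Koopman group, whose local observables are EXACTLY the span of the flow-orbit
`{u ∘ φ_s : u ∈ 𝒫, s ∈ ℝ}` of the local polynomials.
[cite: Doyon2022, §4.1 Def. 4.3–4.4 and §4.3 Thm 4.11] -/
theorem pencilFramework_datum : ∀ (ω₂ lam β γ : ℝ) (D : Literature.MathematicalPhysics.KineticTheory.HeatConduction.InfiniteChainDynamics (Literature.MathematicalPhysics.KineticTheory.HeatConduction.pinnedChain ω₂ lam β γ)), D.flow 0 = id → (∀ t s : ℝ, D.flow (t + s) = D.flow t ∘ D.flow s) → (∀ (t : ℝ) (x : ℤ), D.flow t ∘ Literature.MathematicalPhysics.KineticTheory.HeatConduction.chainShift x = Literature.MathematicalPhysics.KineticTheory.HeatConduction.chainShift x ∘ D.flow t) → (∀ t : ℝ, Literature.MathematicalPhysics.KineticTheory.HeatConduction.chainReversal ∘ D.flow t = D.flow (-t) ∘ Literature.MathematicalPhysics.KineticTheory.HeatConduction.chainReversal)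 → ∀ (μ : MeasureTheory.Measure (ℤ → ℝ × ℝ)) [MeasureTheory.IsProbabilityMeasure μ], D.PreservesMeasure μ → (∀ x : ℤ, MeasureTheory.MeasurePreserving (Literature.MathematicalPhysics.KineticTheory.HeatConduction.chainShift x) μ μ) → MeasureTheory.MeasurePreserving Literature.MathematicalPhysics.KineticTheory.HeatConduction.chainReversal μ μ → (∀ u ∈ Algebra.adjoin ℝ (Set.range fun xc : ℤ × Bool => fun σ : Literature.MathematicalPhysics.KineticTheory.HeatConduction.ChainConfig => if xc.2 then (σ xc.1).2 else (σ xc.1).1), MeasureTheory.MemLp u 2 μ) → (∀ u ∈ Algebra.adjoin ℝ (Set.range fun xc : ℤ × Bool => fun σ : Literature.MathematicalPhysics.KineticTheory.HeatConduction.ChainConfig => if xc.2 then (σ xc.1).2 else (σ xc.1).1), ∀ v ∈ Algebra.adjoin ℝ (Set.range fun xc : ℤ × Bool => fun σ : Literature.MathematicalPhysics.KineticTheory.HeatConduction.ChainConfig => if xc.2 then (σ xc.1).2 else (σ xc.1).1), ∀ t : ℝ, Summable fun x : ℤ => ProbabilityTheory.covariance u ((v ∘ Literature.MathematicalPhysics.KineticTheory.HeatConduction.chainShift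 x) ∘ D.flow t) μ) → (∀ u ∈ Algebra.adjoin ℝ (Set.range fun xc : ℤ × Bool => fun σ : Literature.MathematicalPhysics.KineticTheory.HeatConduction.ChainConfig => if xc.2 then (σ xc.1).2 else (σ xc.1).1), ContinuousAt (fun t : ℝ => ∑' x : ℤ, ProbabilityTheory.covariance u ((u ∘ Literature.MathematicalPhysics.KineticTheory.HeatConduction.chainShift x) ∘ D.flow t) μ) 0) → ∃ Z : Literature.MathematicalPhysics.KineticTheory.HeatConduction.ZeroWavenumberData (Literature.MathematicalPhysics.KineticTheory.HeatConduction.pinnedChain ω₂ lam β γ) D, Z.μ = μ ∧ Z.HasMomentumReversal ∧ Z.toFluctuationDynamics.IsStronglyContinuous ∧ Z.localObs = Submodule.span ℝ {w : Literature.MathematicalPhysics.KineticTheory.HeatConduction.ChainConfig → ℝ | ∃ u ∈ Algebra.adjoin ℝ (Set.range fun xc : ℤ × Bool => fun σ : Literature.MathematicalPhysics.KineticTheory.HeatConduction.ChainConfig => if xc.2 then (σ xc.1).2 else (σ xc.1).1), ∃ s : ℝ, w = u ∘ D.flow s} := by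
  -- adapted from `MourreDissolution.exists_zeroWavenumberData_of_clustering` (`{j₀,h₀}` ↦ `𝒫`)
  intro ω₂ lam β γ D h0 hgrp hsh hrev μ _ hpres hT hRμ hmem hsum hcont
  classical
  set S : Set (ChainConfig → ℝ) := {w : ChainConfig → ℝ | ∃ u ∈ Algebra.adjoin ℝ (Set.range
    fun xc : ℤ × Bool => fun σ : ChainConfig => if xc.2 then (σ xc.1).2 else (σ xc.1).1),
      ∃ s : ℝ, w = u ∘ D.flow s} with hS
  set V : Submodule ℝ (ChainConfig → ℝ) := Submodule.span ℝ S with hVdef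
  have hflow : ∀ t, MeasurePreserving (D.flow t) μ μ := hpres.2
  have hGS : ∀ u ∈ Algebra.adjoin ℝ (Set.range fun xc : ℤ × Bool => fun σ : ChainConfig =>
      if xc.2 then (σ xc.1).2 else (σ xc.1).1), u ∈ S := fun u hu =>
    ⟨u, hu, 0, by rw [h0, Function.comp_id]⟩
  have hgenS : ∀ u ∈ Algebra.adjoin ℝ (Set.range fun xc : ℤ × Bool => fun σ : ChainConfig =>
      if xc.2 then (σ xc.1).2 else (σ xc.1).1), ∀ s : ℝ, u ∘ D.flow s ∈ S := fun u hu s =>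
    ⟨u, hu, s, rfl⟩
  -- square integrability on `S` and on the span
  have hSmem : ∀ b ∈ S, MemLp b 2 μ := by
    rintro b ⟨u, hu, s, rfl⟩
    exact (hmem u hu).comp_measurePreserving (hflow s)
  have hVmem : ∀ ⦃v : ChainConfig → ℝ⦄, v ∈ V → MemLp v 2 μ := by
    intro v hv
    induction hv using Submodule.span_induction with
    | mem b hb => exact hSmem b hb
    | zero => exact MemLp.zero
    | add b b' _ _ hb hb' => exact hb.add hb'
    | smul c b _ hb => exact hb.const_smul c
  -- stability of `S` (hence of `V`) under translations and the flow
  have hV_shift : ∀ (y : ℤ) ⦃v : ChainConfig → ℝ⦄, v ∈ V → v ∘ chainShift y ∈ V := by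
    intro y v hv
    refine MourreDissolution.comp_mem_span_of_forall (chainShift y) (fun b hb => ?_) hv
    obtain ⟨u, hu, s, rfl⟩ := hb
    have e : (u ∘ D.flow s) ∘ chainShift y = (u ∘ chainShift y) ∘ D.flow s := by
      rw [Function.comp_assoc, hsh s y]
      rfl
    rw [e]
    exact Submodule.subset_span (hgenS _ (comp_chainShift_mem_polyObs y hu) s)
  have hV_flow : ∀ (t : ℝ) ⦃v : ChainConfig → ℝ⦄, v ∈ V → v ∘ D.flow t ∈ V := by
    intro t v hv
    refine MourreDissolution.comp_mem_span_of_forall (D.flow t) (fun b hb => ?_) hv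
    obtain ⟨u, hu, s, rfl⟩ := hb
    have e : (u ∘ D.flow s) ∘ D.flow t = u ∘ D.flow (s + t) := by
      rw [hgrp s t]
      rfl
    rw [e]
    exact Submodule.subset_span (hgenS u hu _)
  -- summable clustering: generators, then the span
  have hSS : ∀ b₁ ∈ S, ∀ b₂ ∈ S,
      Integrable (fun x : ℤ => cov[b₁, b₂ ∘ chainShift x; μ]) (Measure.count : Measure ℤ) := by
    rintro b₁ ⟨u, hu, s₁, rfl⟩ b₂ ⟨v, hv, s₂, rfl⟩
    have e : (fun x : ℤ => cov[u ∘ D.flow s₁, (v ∘ D.flow s₂) ∘ chainShift x; μ]) =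
        fun x : ℤ => cov[u, (v ∘ chainShift x) ∘ D.flow (s₂ - s₁); μ] :=
      funext fun x => cov_flow_flow_shift hgrp hsh hflow hT (hmem u hu).aestronglyMeasurable
        (hmem v hv).aestronglyMeasurable x s₁ s₂
    rw [e, integrable_count_iff]
    simpa only [Real.norm_eq_abs] using (hsum u hu v hv (s₂ - s₁)).abs
  have hVint : ∀ ⦃v : ChainConfig → ℝ⦄, v ∈ V → ∀ ⦃w : ChainConfig → ℝ⦄, w ∈ V →
      Integrable (fun x : ℤ => cov[v, w ∘ chainShift x; μ]) (Measure.count : Measure ℤ) :=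
    fun v hv w hw => integrable_count_cov_of_span chainShift hT (fun a ha => hVmem ha) hSS v hv w hw
  -- the datum
  let Z : ZeroWavenumberData (pinnedChain ω₂ lam β γ) D :=
    { μ := μ
      isProbabilityMeasure := inferInstance
      measurePreserving_shift := hT
      localObs := V
      memLp_of_mem := hVmem
      comp_shift_mem := hV_shift
      integrable_cov := hVint
      form_self_nonneg := @fun a ha =>
        integral_count_covariance_comp_shift_nonneg chainShift hT (hVmem ha) (hVint ha ha)
      ae_mem_carrier := hpres.1
      measurePreserving_flow := hflow
      flow_comm_shift := fun t x => Eventually.of_forall fun σ => congrFun (hsh t x) σ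
      comp_flow_mem := hV_flow
      bondCurrent_mem := Submodule.subset_span (hGS _ (bondCurrentZ_mem_polyObs ω₂ lam β γ))
      energyDensity_mem := Submodule.subset_span (hGS _ (energyDensityZ_mem_polyObs ω₂ lam β γ)) }
  -- `R`-stability of `V`
  have hV_R : ∀ ⦃v : ChainConfig → ℝ⦄, v ∈ V → v ∘ chainReversal ∈ V := by
    intro v hv
    refine MourreDissolution.comp_mem_span_of_forall chainReversal (fun b hb => ?_) hv
    obtain ⟨u, hu, s, rfl⟩ := hb
    have e : (u ∘ D.flow s) ∘ chainReversal = (u ∘ chainReversal) ∘ D.flow (-s) := by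
      have h1 : D.flow s ∘ chainReversal = chainReversal ∘ D.flow (-s) := by
        have := hrev (-s); rw [neg_neg] at this; exact this.symm
      rw [Function.comp_assoc, h1]
      rfl
    rw [e]
    exact Submodule.subset_span (hgenS _ (comp_chainReversal_mem_polyObs hu) _)
  -- strong continuity from the generator autocorrelations
  have hsc : Z.toFluctuationDynamics.IsStronglyContinuous := by
    refine Z.toFluctuationDynamics.isStronglyContinuous_of_generators
      (↑(Algebra.adjoin ℝ (Set.range fun xc : ℤ × Bool => fun σ : ChainConfig =>
        if xc.2 then (σ xc.1).2 else (σ xc.1).1)) : Set (ChainConfig → ℝ))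
      (fun u hu => Submodule.subset_span (hGS u hu)) ?_ ?_
    · refine Submodule.span_le.2 ?_
      rintro b ⟨u, hu, s, rfl⟩
      refine Submodule.subset_span ⟨u, hu, 0, s, ?_⟩
      funext σ
      simp only [comp_apply, ZeroWavenumberData.toFluctuationDynamics_flow, ShiftAction.apply_zero]
    · intro u hu
      have huV : u ∈ V := Submodule.subset_span (hGS u hu)
      have hform : (fun t : ℝ => Z.toFluctuationDynamics.form u (u ∘ Z.toFluctuationDynamics.flow t)) =
          fun t : ℝ => ∑' x : ℤ, cov[u, (u ∘ chainShift x) ∘ D.flow t; μ] := by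
        funext t
        rw [ZeroWavenumberData.toFluctuationDynamics_flow]
        show Z.form u (u ∘ D.flow t) = _
        rw [Z.form_eq_tsum huV (hV_flow t huV)]
        refine tsum_congr fun x => ?_
        have e : (u ∘ D.flow t) ∘ chainShift x = (u ∘ chainShift x) ∘ D.flow t := by
          rw [Function.comp_assoc, hsh t x]
          rfl
        rw [e]
      rw [hform]
      exact hcont u hu
  exact ⟨Z, rfl, ⟨hRμ, hV_R, fun t => Eventually.of_forall fun σ => congrFun (hrev t) σ⟩, hsc, rfl⟩

end Summit.AtomisticToContinuum.FouriersLaw.Theorems.DrudeDissolution.GramPencilHarmonicChaos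

end
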